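import Summits.BirchSwinnertonDyer.BirchSwinnertonDyer.Theorems.ManinLocalTwoThreePinningKernelFricke
import Summits.BirchSwinnertonDyer.BirchSwinnertonDyer.Theorems.ManinLocalTwoThreePinningKernelStaged
import Summits.BirchSwinnertonDyer.BirchSwinnertonDyer.Theorems.ManinLocalTwoThreePinningKernelCusp
import Summits.BirchSwinnertonDyer.BirchSwinnertonDyer.Theorems.ManinLocalTwoThreePinningTwoFiftyTwoStagesH
import Literature.NumberTheory.EllipticCurves.ModularFormsGamma0WeightTwoDimension
import HarnessLib

/-!
# Level 252 (genus 37) by the PINNING KERNEL IN `S₂`: THE NEWFORM OF EVERY `X₀(252)`-DATUM IS `F_{252a, 252b}`, FACT-FREE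

Cell `bsd-f2-manin`, route `ManinLocalTwoThree`, crux C2 `ManinOddAtFour` (stmt-BirchSwinnertonDyer-22967) AND C3 `ManinPrimeToThreeAtNine`
(stmt-BirchSwinnertonDyer-22968; `4 ∣ 252` and `9 ∣ 252`: the level lies in BOTH crux domains), an g57 (LENS
analytic/periods); `--supports stmt-BirchSwinnertonDyer-22967` (helper).  INSTANCE of `…PinningKernel{Sieve,,Fricke,Staged,Cusp}`: the
level-144 template with the kernel run in the CUSP space (part G `…PinningKernelCusp`: `dim S₂(Γ₀(252)) = g = 37` instead of
`dim M₂ = 60`; at `ν_∞ = 24` cusps the Eisenstein part would double the basis and quadruple the sieve) and the script-emitted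
data of level 252 (`an/g57/scripts/pk_data57.py 252 192` with `SPACE=S FIXN=3 OMIN=1 RELPRUNE=1 COSTMIN=1 PIVCLOSED=1 PLIST=2,3,5,7,11,13,17 PORDER=2,3,5,7,13,11,17 LOADENUM=cuspenum252_f20e4.json`,
`emit_level56.py 252 S`, `emit_levelfile56.py`, the an g57 splitters);
kernel certificates only, no level-specific algebra; the data and the table
certificates are parts 1–9 (`…PinningTwoFiftyTwoTables`, `…TablesB`, …, `…TablesI`), the staged sieve certificates `hst0 … hst6` are parts 10–17 (`…PinningTwoFiftyTwoStagesA` … `…StagesH`);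
this file is part 18 (duals, cover, Fricke sieve, dimension, pinning).

THE RESULT.  `S₂(Γ₀(252))` (dimension `37 = g`) is spanned by 37 CUSPIDAL `η`-quotients (`Ls`, closed under the Fricke
reflection `σ`; strict Ligozat positivity `hcusp`), whose `M₂`-images `C₀,…` have certified tables to depth `192` and integer duals
(`d = 1728`).  The staged box sieve over the primes `2, 3, 5, 7, 13, 11, 17` with the certified column relations leaves
25 prime assignment(s) (`certs`); the Fricke sieve keeps `goodCerts` (Cremona `252a, 252b`; the others are old classes, killed
for both signs by `decide`): **`pinning_cusp (D)`**: for some `(σ, d′, y) ∈ goodCerts`, `truth W = σ ∧ d′ • D.f = Σ_j y_j • S_j`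
in `S₂(Γ₀(252))` `∧ d′ • D.f = Σ_j y_j • C_j` in `M₂(Γ₀(252))`, for every `X₀(252)`-datum `D` of any elliptic `W/ℚ`; **`pinning (D)`**:
the `M₂`-reading alone (same statement shape as the `M₂`-levels, so part F's row lemmas and the capstones apply verbatim).
HONEST FRAMING: unconditional, standard axioms; no newness/eigen statement about the combination is proved; the Néron/`c`-side
at `252` is NOT touched; nothing here proves C2/C3, Manin's conjecture or BSD.
[cite: CremonaAlgorithms1997, §2.10, Table 1 (252a, 252b)] [cite: AtkinLehner1970, Thm. 3] [cite: Koehler2011, §2.1, §2.4]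
[cite: Ligozat1975, Ch. 3] [cite: DiamondShurman2005, Thm. 3.5.1]
-/

set_option autoImplicit false
-- lint-debt: the directory name repeats the summit name (sibling precedent `ManinLocalTwoThreePinningSixtyThree.lean`)
set_option linter.dupNamespace false

noncomputable section


open Complex
open UpperHalfPlane hiding I
open scoped MatrixGroups ModularForm
open ModularForm CongruenceSubgroup
open Literature.NumberTheory.ModularForms
open Literature.NumberTheory.EllipticCurves Literature.NumberTheory.EllipticCurves.ModularForms

namespace Summit.BirchSwinnertonDyer.BirchSwinnertonDyer.Theorems.ManinLocalTwoThree.PinningTwoFiftyTwo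

open Summit.BirchSwinnertonDyer.BirchSwinnertonDyer.Theorems.ManinLocalTwoThree.BracketSturm
open Summit.BirchSwinnertonDyer.BirchSwinnertonDyer.Theorems.ManinLocalTwoThree.PinningKernel


set_option maxHeartbeats 4000000
set_option maxRecDepth 16384

/-! ## §2d Duals and relations; §2e (after parts 10–17) the cover, the Fricke data -/

/-- Rows `0 ≤ i < 6` of the dual certificate (chunk 1 of 6; one kernel reduction each). [folklore] -/
theorem hdualc0 : ∀ i j : Fin 37, i.val < 6 → dotList (duals i) (tabs j) = if i = j then (1728 : ℤ) else 0 := by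
  decide +kernel

/-- Rows `6 ≤ i < 12` of the dual certificate (chunk 2 of 6; one kernel reduction each). [folklore] -/
theorem hdualc1 : ∀ i j : Fin 37, 6 ≤ i.val → i.val < 12 → dotList (duals i) (tabs j) = if i = j then (1728 : ℤ) else 0 := by
  decide +kernel

/-- Rows `12 ≤ i < 18` of the dual certificate (chunk 3 of 6; one kernel reduction each). [folklore] -/
theorem hdualc2 : ∀ i j : Fin 37, 12 ≤ i.val → i.val < 18 → dotList (duals i) (tabs j) = if i = j then (1728 : ℤ) else 0 := by
  decide +kernel

/-- Rows `18 ≤ i < 25` of the dual certificate (chunk 4 of 6; one kernel reduction each). [folklore] -/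
theorem hdualc3 : ∀ i j : Fin 37, 18 ≤ i.val → i.val < 25 → dotList (duals i) (tabs j) = if i = j then (1728 : ℤ) else 0 := by
  decide +kernel

/-- Rows `25 ≤ i < 31` of the dual certificate (chunk 5 of 6; one kernel reduction each). [folklore] -/
theorem hdualc4 : ∀ i j : Fin 37, 25 ≤ i.val → i.val < 31 → dotList (duals i) (tabs j) = if i = j then (1728 : ℤ) else 0 := by
  decide +kernel

/-- Rows `31 ≤ i < 37` of the dual certificate (chunk 6 of 6; one kernel reduction each). [folklore] -/
theorem hdualc5 : ∀ i j : Fin 37, 31 ≤ i.val → dotList (duals i) (tabs j) = if i = j then (1728 : ℤ) else 0 := by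
  decide +kernel

/-- **The dual certificate** `⟨dualsᵢ, tabsⱼ⟩ = 1728·δᵢⱼ`. [folklore] -/
theorem hdual : ∀ i j : Fin 37, dotList (duals i) (tabs j) = if i = j then (1728 : ℤ) else 0 := by
  intro i j
  by_cases h0 : i.val < 6
  · exact hdualc0 i j h0
  by_cases h1 : i.val < 12
  · exact hdualc1 i j (by omega) h1
  by_cases h2 : i.val < 18
  · exact hdualc2 i j (by omega) h2
  by_cases h3 : i.val < 25
  · exact hdualc3 i j (by omega) h3
  by_cases h4 : i.val < 31
  · exact hdualc4 i j (by omega) h4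
  · exact hdualc5 i j (by omega)

/-- The dual vectors live below depth `192`. [folklore] -/
theorem hlen : ∀ i : Fin 37, (duals i).length ≤ 192 := by
  decide +kernel

/-- **The relation certificate**: every stage relation is a column relation of the tables. [folklore] -/
theorem hrel : ∀ st ∈ stages, ∀ v ∈ st.2, v.length ≤ 192 ∧ ∀ j : Fin 37, dotList v (tabs j) = 0 := by
  decide +kernel

/-- **THE SIEVE**, certified one stage at a time (`hst0 … hst6`: stage `k` maps the live list `L_k` into `L_{k+1}`),
assembled by `PinningKernel.runSieve_subset_of_chain` (part D `…PinningKernelStaged`): the staged box sieve returns only assignments listed in `certs`.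
[cite: CremonaAlgorithms1997, §2.10] -/
theorem hcover : ∀ σ ∈ runSieve 252 192 stages, σ ∈ certs.map Prod.fst := by
  have hch : ∀ k < stages.length, ∀ σ ∈ sieveStep 252 192 ((([[]] : List (List (ℕ × ℤ))) :: lvs).getD k [])
      (stages.getD k (0, [])), σ ∈ lvs.getD k [] := by
    intro k hk
    have hk' : k < 7 := lt_of_lt_of_eq hk (by decide)
    interval_cases k
    exacts [hst0, hst1, hst2, hst3, hst4, hst5, hst6]
  have hlast : ((([[]] : List (List (ℕ × ℤ))) :: lvs).getD stages.length []) = certs.map Prod.fst := by decide +kernel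
  exact fun σ hσ ↦ hlast ▸ runSieve_subset_of_chain 252 192 stages lvs (by decide) hch σ hσ

/-- **The coordinate certificates** `d'·aₙ(σ) = Σ_j y_j·tabsⱼ[n]` on the dual support. [folklore] -/
theorem hpiv : ∀ c ∈ certs, ∀ i : Fin 37, ∀ n < (duals i).length, (duals i).getD n 0 ≠ 0 →
    (evalOpt 252 c.1 n).map (fun x ↦ c.2.1 * x) = some (∑ j : Fin 37, c.2.2.getD (j : ℕ) 0 * (tabs j).getD n 0) := by
  decide +kernel

/-- Every exponent row sums to `4` (weight `2`). [folklore] -/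
theorem hsum : ∀ i : Fin 37, ∑ δ ∈ (252 : ℕ).divisors, expFn (Ls[(i : ℕ)]).1 δ = 4 := by
  decide +kernel

/-- The basis is `σ`-closed: `r_i(252/δ) = r_{σ i}(δ)` on the divisors. [cite: Koehler2011, §2.4] -/
theorem hsig : ∀ i : Fin 37, ∀ δ ∈ (252 : ℕ).divisors,
    EtaFricke.frickeExp 252 (expFn (Ls[(i : ℕ)]).1) δ = expFn (Ls[((sig i : Fin 37) : ℕ)]).1 δ := by
  decide +kernel

/-- The Fricke constants: `knum² · ∏_{r>0} δ^r = 252² · kden² · ∏_{r<0} δ^{−r}`. [cite: Koehler2011, §2.4] -/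
theorem hK : ∀ i : Fin 37, 0 < knum i ∧ 0 < kden i ∧
    knum i ^ 2 * posPart 252 (expFn (Ls[(i : ℕ)]).1) = 252 ^ 2 * kden i ^ 2 * negPart 252 (expFn (Ls[(i : ℕ)]).1) := by
  decide +kernel

/-- `σ` is injective. [folklore] -/
theorem hinj : Function.Injective sig := by
  decide

/-- Only the `252a, 252b` certificates pass the Fricke-row check (each for one sign). [folklore] -/
theorem hfr : ∀ c ∈ certs, (frickeRowsOK sig knum kden 1 c.2.2 = true ∨ frickeRowsOK sig knum kden (-1) c.2.2 = true) →
    c ∈ goodCerts := by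
  decide

/-- The stage primes are prime. [folklore] -/
theorem hps : ∀ st ∈ stages, st.1.Prime := by
  intro st hst
  have h : st.1 ∈ stages.map Prod.fst := List.mem_map.mpr ⟨st, hst, rfl⟩
  have hl : stages.map Prod.fst = [2, 3, 5, 7, 13, 11, 17] := by decide
  rw [hl] at h
  simp only [List.mem_cons, List.mem_nil_iff, or_false] at h
  rcases h with h | h | h | h | h | h | h <;> rw [h] <;> norm_num

/-! ## §3 `dim S₂(Γ₀(252)) = 37` -/

/-- `μ(Γ₀(252)) = 576`, `ν_∞ = 24`, `ν₂ = ν₃ = 0`. [cite: DiamondShurman2005, §3.8] -/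
theorem gamma0_data : gamma0Index 252 = 576 ∧ nuInfty 252 = 24 ∧ nu₂ 252 = 0 ∧ nu₃ 252 = 0 := by
  refine ⟨?_, by decide, by rw [nu₂_eq_card]; decide, by rw [nu₃_eq_card]; decide⟩
  · rw [(gamma0Index_mul (m := 4) (n := 63) (by norm_num)), (gamma0Index_mul (m := 9) (n := 7) (by norm_num)),
      show (4 : ℕ) = 2 ^ 2 by norm_num, gamma0Index_prime_pow (p := 2) (e := 2) Nat.prime_two (by norm_num),
      show (9 : ℕ) = 3 ^ 2 by norm_num, gamma0Index_prime_pow (p := 3) (e := 2) Nat.prime_three (by norm_num),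
      gamma0Index_prime (by norm_num : Nat.Prime 7)]
    norm_num

/-- **`dim S₂(Γ₀(252)) = 37`** (the genus; `μ = 576`, `ν_∞ = 24`), by the tree's `finrank_cuspForm_two_eq_genusX0_holds`.
[cite: DiamondShurman2005, Thm. 3.5.1] -/
theorem finrank_cuspForm_two : Module.finrank ℂ (CuspForm (Gamma0 252) 2) = 37 := by
  obtain ⟨h1, h2, h3, h4⟩ := gamma0_data
  have h : Module.finrank ℂ (CuspForm (Gamma0 252) 2) = genusX0 252 := finrank_cuspForm_two_eq_genusX0_holds 252
  rw [h, genusX0, h1, h2, h3, h4]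

/-! ## §4 The pinning (2 classes; kernel in `S₂`, read in `M₂` by part G `…PinningKernelCusp`) -/

/-- **LEVEL 252 PINNED IN `S₂(Γ₀(252))` (one of 2 newform classes).**  For every `X₀(252)`-datum of an elliptic `W/ℚ`, with
the cuspidal `η`-quotients `Sᵢ` of `Ls` and their `M₂`-images `Cᵢ`: for some certificate `c = (σ, d', y) ∈ goodCerts` (Cremona
`252a, 252b`; the old classes are killed by the Fricke rows), the sieve truth of `W` is `σ`, `d' • D.f = Σ_j y_j • S_j` in `S₂(Γ₀(252))`
and `d' • f = Σ_j y_j • C_j` in `M₂(Γ₀(252))`. [cite: CremonaAlgorithms1997, §2.10, Table 1 (252a, 252b)] [cite: AtkinLehner1970, Thm. 3] -/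
theorem pinning_cusp {W : WeierstrassCurve ℚ} [W.IsElliptic] (D : ModularParametrizationData W 252) :
    ∃ S : Fin 37 → CuspForm (Gamma0 252) 2, ∃ C : Fin 37 → ModularForm (Gamma0 252) 2,
      (∀ i, ModularFormClass.modularForm (S i) = C i) ∧ (∀ i, ∀ τ : ℍ, C i τ = etaQuotient 252 (expFn (Ls[(i : ℕ)]).1) τ) ∧
      ∃ c ∈ goodCerts, truth W (stages.map Prod.fst) = c.1 ∧
        ((c.2.1 : ℤ) : ℂ) • D.f = ∑ j : Fin 37, ((c.2.2.getD (j : ℕ) 0 : ℤ) : ℂ) • S j ∧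
        ((c.2.1 : ℤ) : ℂ) • ModularFormClass.modularForm D.f = ∑ j : Fin 37, ((c.2.2.getD (j : ℕ) 0 : ℤ) : ℂ) • C j := by
  obtain ⟨S, hS⟩ := exists_etaCuspForms 252 Ls hcusp
  obtain ⟨C, hCS⟩ : ∃ C : Fin 37 → ModularForm (Gamma0 252) 2, ∀ i, ModularFormClass.modularForm (S i) = C i :=
    ⟨_, fun _ ↦ rfl⟩
  have hC : ∀ i, ∀ τ : ℍ, C i τ = etaQuotient 252 (expFn (Ls[(i : ℕ)]).1) τ := fun i τ ↦ by rw [← hCS]; exact hS i τ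
  have ht := tables_of_etaCertsSparse 252 192 (fun i : Fin 37 ↦ expFn (Ls[(i : ℕ)]).1) (fun i ↦ shifts i) tabs C hC hshift hcert
  obtain ⟨c, hc, hc1, hpinS, hpin⟩ := exists_smul_eq_sum_of_certs_cusp 252 D S C hCS tabs duals 1728 ht hlen hdual (by norm_num)
    finrank_cuspForm_two stages hps hrel certs hcover hpiv
  -- the Fricke sieve (part C), on the `M₂`-images
  have hli : LinearIndependent ℂ C := linearIndependent_of_dual C tabs duals 1728 ht hlen hdual (by norm_num)
  have hW := slash_eq_sum_frickePhi C (fun i : Fin 37 ↦ expFn (Ls[(i : ℕ)]).1) hC sig knum kden hsum hsig hK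
  have hd' : c.2.1 ≠ 0 := by
    simp only [certs, List.mem_cons, List.mem_nil_iff, or_false] at hc
    rcases hc with rfl | rfl | rfl | rfl | rfl | rfl | rfl | rfl | rfl | rfl | rfl | rfl | rfl | rfl | rfl | rfl | rfl | rfl | rfl | rfl | rfl | rfl | rfl | rfl | rfl <;> decide
  have hrows := frickeRows_of_pinning D C hli sig hinj knum kden (fun i ↦ (hK i).2.1) hW hd' c.2.2 hpin
  exact ⟨S, C, hCS, hC, c, hfr c hc hrows, hc1.symm, hpinS, hpin⟩

/-- **LEVEL 252 PINNED, `M₂`-READING** (the statement shape of the `M₂`-levels, consumed by part F's row lemmas and the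
capstones): for some `(σ, d′, y) ∈ goodCerts`, `truth W = σ ∧ d′ • f = Σ_j y_j • C_j` in `M₂(Γ₀(252))`.
[cite: CremonaAlgorithms1997, §2.10, Table 1 (252a, 252b)] [cite: AtkinLehner1970, Thm. 3] -/
theorem pinning {W : WeierstrassCurve ℚ} [W.IsElliptic] (D : ModularParametrizationData W 252) :
    ∃ C : Fin 37 → ModularForm (Gamma0 252) 2, (∀ i, ∀ τ : ℍ, C i τ = etaQuotient 252 (expFn (Ls[(i : ℕ)]).1) τ) ∧
      ∃ c ∈ goodCerts, truth W (stages.map Prod.fst) = c.1 ∧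
        ((c.2.1 : ℤ) : ℂ) • ModularFormClass.modularForm D.f = ∑ j : Fin 37, ((c.2.2.getD (j : ℕ) 0 : ℤ) : ℂ) • C j := by
  obtain ⟨S, C, -, hC, c, hc, h1, -, h2⟩ := pinning_cusp D
  exact ⟨C, hC, c, hc, h1, h2⟩

end Summit.BirchSwinnertonDyer.BirchSwinnertonDyer.Theorems.ManinLocalTwoThree.PinningTwoFiftyTwo

end
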